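import Literature.Analysis.FluidPDE.CompressibleEulerImplosionFarFieldBounds
import Literature.Analysis.FluidPDE.IsentropicEulerTorusUniqueness
import Literature.Analysis.FunctionSpaces.TorusMollifier
import Literature.Analysis.Calculus.MixedPartialBound

/-!
# Rate clauses of the periodic Type-I implosion: tools

Helper file for the support item `TypeOneIdealImplosion` (stmt-AtomisticToContinuum-15146) of the
route `ImplosionDichotomy` (`AtomisticToContinuum/HydrodynamicLimit`). The periodic implosion is
glued from the exact self-similar solution `E` (core, `|y| < 1/8` in the fundamental cell) and a
smooth exterior solution `τ` (`|y| > 3/32`); its four RATE clauses (Type-I gradient bounds,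
polynomial bounds on all derivatives, polynomial density floor, core growth — the clauses of
`Literature.Analysis.FluidPDE.CaolaboraEtAl2025_thm12_rates`) are read off `E` in the core (exact
scaling `∇ⁿ_x = (T−t)^{−n/r}∇ⁿ_y`, bounded profile derivatives
`Literature.Analysis.FluidPDE.CaolaboraEtAl2025.exists_bound_iteratedFDeriv_profile`) and off the
smoothness of `τ` on a compact time slab in the exterior. This file supplies the generic tools:

* `norm_reprc_le_one`, `iteratedFDeriv_lift_eq_reprc` — derivatives of periodic lifts may be
  evaluated at the centred representative;
* `exists_bound_iteratedFDeriv_lift_slice` — for a field jointly smooth on `[0, T_b) × 𝕋³` and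
  `T < T_b`, all space derivatives of the lifts of the slices are bounded on `(0, T] × ℝ³`
  (compactness of `[0, T] ×` a fundamental domain for the within-derivative, and the slice bound
  `Literature.Analysis.Calculus.norm_iteratedFDeriv_slice_right_le`);
* `norm_iteratedFDeriv_smul_comp_smul_le` — `‖Dⁿ(a • g(e • ·))‖ ≤ |a| |e|ⁿ sup‖Dⁿg‖`;
* `exists_bound_partialDeriv_slice`, `exists_pos_le_slice` — first space derivatives of lifts
  are bounded, and positive fields are bounded below, on `(0, T] × 𝕋³`.

Folklore calculus.
-/

noncomputable section

namespace Summit.AtomisticToContinuum.HydrodynamicLimit.Theorems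

open Set Filter Topology Metric Function
open scoped ContDiff
open Literature.MathematicalPhysics.KineticTheory
open Literature.Analysis.FunctionSpaces Literature.Analysis.FunctionSpaces.Torus

/-! ## Periodic lifts: evaluation at the centred representative -/

/-- The centred representative has norm `≤ 1` (each coordinate has modulus `≤ 1/2`). [folklore] -/
theorem norm_reprc_le_one (z : T3) : ‖reprc z‖ ≤ 1 := by
  have h : ‖reprc z‖ ^ 2 ≤ 1 := by
    rw [EuclideanSpace.real_norm_sq_eq]
    calc ∑ i : Fin 3, reprc z i ^ 2 ≤ ∑ _i : Fin 3, (1 / 4 : ℝ) := Finset.sum_le_sum fun i _ => by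
            have h := abs_reprc_apply_le z i
            nlinarith [abs_nonneg (reprc z i), sq_abs (reprc z i)]
      _ ≤ 1 := by simp; norm_num
  nlinarith [norm_nonneg (reprc z)]

/-- **Derivatives of a periodic lift are periodic**: they may be evaluated at the centred
representative `reprc (proj y)` of `y`. [folklore] -/
theorem iteratedFDeriv_lift_eq_reprc {F : Type*} [NormedAddCommGroup F] [NormedSpace ℝ F]
    (f : T3 → F) (n : ℕ) (y : V3) :
    iteratedFDeriv ℝ n (lift f) y = iteratedFDeriv ℝ n (lift f) (reprc (proj y)) := by
  set m : V3 := y - reprc (proj y) with hm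
  have hpm : proj m = 0 := by
    rw [hm, show ∀ a b : V3, proj (a - b) = proj a - proj b from fun _ _ => rfl, proj_reprc, sub_self]
  have hper : (fun z => lift f (z + m)) = lift f := by
    funext z
    simp only [lift_apply, proj_add, hpm, add_zero]
  have hy : y = reprc (proj y) + m := by rw [hm]; abel
  conv_lhs => rw [hy, ← iteratedFDeriv_comp_add_right n m (reprc (proj y)), hper]

/-! ## Uniform bounds for slices of jointly smooth space–time fields -/

section SliceBounds

variable {F : Type*} [NormedAddCommGroup F] [NormedSpace ℝ F]

/-- **All space derivatives of the slices of a jointly smooth field are bounded on `(0, T] × ℝ³`**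
(`T < T_b`, the field jointly smooth on `[0, T_b) × 𝕋³`): the within-derivative of the
space–time lift is continuous on the compact `[0, T] × B̄(0, 1)`, dominates the slice derivative
at interior times, and periodicity covers all of `ℝ³`. [folklore] -/
theorem exists_bound_iteratedFDeriv_lift_slice {Tb T : ℝ} {φ : ℝ → T3 → F}
    (hφ : IsSmoothSpaceTimeOn (Ico 0 Tb) φ) (hT : T < Tb) (n : ℕ) :
    ∃ M : ℝ, ∀ s ∈ Ioc 0 T, ∀ y : V3, ‖iteratedFDeriv ℝ n (lift (φ s)) y‖ ≤ M := by
  set g : ℝ × V3 → F := stLift φ with hg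
  have hU : UniqueDiffOn ℝ (Ico (0 : ℝ) Tb ×ˢ (univ : Set V3)) :=
    (uniqueDiffOn_Ico 0 Tb).prod uniqueDiffOn_univ
  -- continuity of the within-derivative on the slab, bound on the compact part
  have hcont : ContinuousOn (iteratedFDerivWithin ℝ n g (Ico 0 Tb ×ˢ univ)) (Ico 0 Tb ×ˢ univ) :=
    hφ.continuousOn_iteratedFDerivWithin (by exact_mod_cast le_top) hU
  have hK : IsCompact (Icc (0 : ℝ) T ×ˢ closedBall (0 : V3) 1) :=
    isCompact_Icc.prod (isCompact_closedBall 0 1)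
  have hKsub : Icc (0 : ℝ) T ×ˢ closedBall (0 : V3) 1 ⊆ Ico 0 Tb ×ˢ univ :=
    prod_mono (Icc_subset_Ico_right hT) (subset_univ _)
  obtain ⟨M, hM⟩ := hK.exists_bound_of_continuousOn (hcont.mono hKsub)
  refine ⟨M, fun s hs y => ?_⟩
  -- periodicity: evaluate at the centred representative
  rw [iteratedFDeriv_lift_eq_reprc]
  set y' : V3 := reprc (proj y) with hy'
  have hs' : s ∈ Ioo 0 Tb := ⟨hs.1, hs.2.trans_lt hT⟩
  -- the slice derivative is dominated by the joint derivative (interior time)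
  have hg' : ContDiffOn ℝ ∞ g (Ioo 0 Tb ×ˢ univ) := hφ.mono Ioo_subset_Ico_self
  have h1 : ‖iteratedFDeriv ℝ n (fun ξ => g (s, ξ)) y'‖ ≤ ‖iteratedFDeriv ℝ n g (s, y')‖ :=
    Literature.Analysis.Calculus.norm_iteratedFDeriv_slice_right_le isOpen_Ioo hg' hs'
      (by exact_mod_cast le_top) y'
  have hslice : (fun ξ => g (s, ξ)) = lift (φ s) := rfl
  rw [hslice] at h1
  -- joint derivative = within-derivative at interior points
  have hopen : IsOpen (Ioo (0 : ℝ) Tb ×ˢ (univ : Set V3)) := isOpen_Ioo.prod isOpen_univ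
  have hmem : (s, y') ∈ Ioo (0 : ℝ) Tb ×ˢ (univ : Set V3) := ⟨hs', mem_univ _⟩
  have h2 : iteratedFDeriv ℝ n g (s, y') = iteratedFDerivWithin ℝ n g (Ico 0 Tb ×ˢ univ) (s, y') := by
    rw [← iteratedFDerivWithin_of_isOpen n hopen hmem]
    have hinter : Ico (0 : ℝ) Tb ×ˢ (univ : Set V3) ∩ (Ioi 0 ×ˢ univ) = Ioo 0 Tb ×ˢ univ := by
      ext p; constructor
      · rintro ⟨⟨h1, -⟩, h2, -⟩; exact ⟨⟨h2, h1.2⟩, mem_univ _⟩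
      · rintro ⟨h1, -⟩; exact ⟨⟨⟨h1.1.le, h1.2⟩, mem_univ _⟩, ⟨h1.1, mem_univ _⟩⟩
    rw [← hinter, iteratedFDerivWithin_inter_open (u := Ioi (0 : ℝ) ×ˢ (univ : Set V3))
      (isOpen_Ioi.prod isOpen_univ) (show (s, y') ∈ Ioi (0 : ℝ) ×ˢ (univ : Set V3) from ⟨hs'.1, mem_univ _⟩)]
  rw [h2] at h1
  refine h1.trans (hM _ ⟨⟨hs.1.le, hs.2⟩, ?_⟩)
  rw [mem_closedBall_zero_iff]
  exact norm_reprc_le_one _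

/-- **First space derivatives of slices are bounded on `(0, T] × 𝕋³`** (torus partial derivatives
of a jointly smooth field, `T < T_b`). [folklore] -/
theorem exists_bound_partialDeriv_slice {Tb T : ℝ} {φ : ℝ → T3 → F}
    (hφ : IsSmoothSpaceTimeOn (Ico 0 Tb) φ) (hT : T < Tb) :
    ∃ M : ℝ, ∀ s ∈ Ioc 0 T, ∀ x (i : Fin 3), ‖partialDeriv i (φ s) x‖ ≤ M := by
  obtain ⟨M, hM⟩ := exists_bound_iteratedFDeriv_lift_slice hφ hT 1
  refine ⟨M, fun s hs x i => ?_⟩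
  obtain ⟨y, rfl⟩ := proj_surjective x
  have hs' : s ∈ Ico 0 Tb := ⟨hs.1.le, hs.2.trans_lt hT⟩
  have h1 : IsContDiff 1 (φ s) := (hφ.isSmooth_slice hs').of_le (mod_cast le_top)
  rw [Literature.Analysis.FluidPDE.IsentropicEuler.partialDeriv_proj_eq h1]
  calc ‖fderiv ℝ (lift (φ s)) y (EuclideanSpace.single i 1)‖
      ≤ ‖fderiv ℝ (lift (φ s)) y‖ * ‖(EuclideanSpace.single i (1 : ℝ) : V3)‖ := ContinuousLinearMap.le_opNorm _ _
    _ = ‖fderiv ℝ (lift (φ s)) y‖ := by rw [PiLp.norm_single, norm_one, mul_one]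
    _ = ‖iteratedFDeriv ℝ 1 (lift (φ s)) y‖ := by rw [← norm_iteratedFDeriv_one (𝕜 := ℝ)]
    _ ≤ M := hM s hs y

/-- **Positive jointly smooth fields are bounded below on `(0, T] × 𝕋³`** (`T < T_b`): continuity on
the compact `[0, T] × 𝕋³`. [folklore] -/
theorem exists_pos_le_slice {Tb T : ℝ} {φ : ℝ → T3 → ℝ} (hφ : IsSmoothSpaceTimeOn (Ico 0 Tb) φ)
    (hpos : ∀ s ∈ Ico 0 Tb, ∀ x, 0 < φ s x) (hT0 : 0 ≤ T) (hT : T < Tb) :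
    ∃ c : ℝ, 0 < c ∧ ∀ s ∈ Icc 0 T, ∀ x, c ≤ φ s x := by
  -- continuity of `(s, y) ↦ φ s (proj y)` on the compact `[0,T] × B̄(0,1)`, minimum attained
  have hcont : ContinuousOn (stLift φ) (Icc 0 T ×ˢ closedBall (0 : V3) 1) :=
    hφ.continuousOn.mono (prod_mono (Icc_subset_Ico_right hT) (subset_univ _))
  have hK : IsCompact (Icc (0 : ℝ) T ×ˢ closedBall (0 : V3) 1) :=
    isCompact_Icc.prod (isCompact_closedBall 0 1)
  have hne : (Icc (0 : ℝ) T ×ˢ closedBall (0 : V3) 1).Nonempty :=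
    ⟨(0, 0), ⟨⟨le_rfl, hT0⟩, mem_closedBall_self zero_le_one⟩⟩
  obtain ⟨p, hp, hmin⟩ := hK.exists_isMinOn hne hcont
  refine ⟨stLift φ p, hpos p.1 ⟨hp.1.1, hp.1.2.trans_lt hT⟩ _, fun s hs x => ?_⟩
  have hx : x = proj (reprc x) := (proj_reprc x).symm
  have hmem : (s, reprc x) ∈ Icc (0 : ℝ) T ×ˢ closedBall (0 : V3) 1 :=
    ⟨hs, mem_closedBall_zero_iff.2 (norm_reprc_le_one x)⟩
  have h := hmin hmem
  simp only [mem_setOf_eq, stLift] at h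
  rw [hx]
  exact h

end SliceBounds

/-! ## Derivatives of rescaled fields -/

/-- **Scaling of derivatives**: if `‖Dⁿg‖ ≤ M` on `ℝ³` then
`‖Dⁿ(z ↦ a • g(e • z))(z)‖ ≤ |a| |e|ⁿ M`. [folklore] -/
theorem norm_iteratedFDeriv_smul_comp_smul_le {F : Type*} [NormedAddCommGroup F] [NormedSpace ℝ F]
    {g : V3 → F} (hg : ContDiff ℝ ∞ g) {n : ℕ} {M : ℝ} (hM : ∀ z, ‖iteratedFDeriv ℝ n g z‖ ≤ M)
    (a e : ℝ) (z : V3) :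
    ‖iteratedFDeriv ℝ n (fun w => a • g (e • w)) z‖ ≤ |a| * |e| ^ n * M := by
  set L : V3 →L[ℝ] V3 := e • ContinuousLinearMap.id ℝ V3 with hL
  have hLapply : ∀ w, L w = e • w := fun w => by simp [hL]
  have hLnorm : ‖L‖ ≤ |e| := by
    refine ContinuousLinearMap.opNorm_le_bound _ (abs_nonneg e) fun w => ?_
    rw [hLapply, norm_smul, Real.norm_eq_abs]
  have hcomp : ContDiff ℝ ∞ fun w => g (e • w) := hg.comp (contDiff_const_smul e)
  have h1 : iteratedFDeriv ℝ n (fun w => a • g (e • w)) z = a • iteratedFDeriv ℝ n (fun w => g (e • w)) z :=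
    iteratedFDeriv_const_smul_apply' ((hcomp.of_le (by exact_mod_cast le_top)).contDiffAt)
  have h2 : iteratedFDeriv ℝ n (fun w => g (e • w)) z =
      (iteratedFDeriv ℝ n g (L z)).compContinuousLinearMap fun _ => L := by
    have h := L.iteratedFDeriv_comp_right hg z (i := n) (by exact_mod_cast le_top)
    have hfun : g ∘ L = fun w => g (e • w) := funext fun w => by simp [hLapply]
    rw [hfun] at h
    exact h
  have hM0 : 0 ≤ M := (norm_nonneg _).trans (hM 0)
  rw [h1, norm_smul, Real.norm_eq_abs, h2, mul_assoc]
  refine mul_le_mul_of_nonneg_left ?_ (abs_nonneg a)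
  refine (ContinuousMultilinearMap.norm_compContinuousLinearMap_le _ _).trans ?_
  rw [mul_comm]
  refine mul_le_mul ?_ (hM _) (norm_nonneg _) (by positivity)
  calc ∏ _i : Fin n, ‖L‖ ≤ ∏ _i : Fin n, |e| := Finset.prod_le_prod (fun _ _ => norm_nonneg _) fun _ _ => hLnorm
    _ = |e| ^ n := by simp

end Summit.AtomisticToContinuum.HydrodynamicLimit.Theorems

end
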